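import Mathlib

/-!
# Uniqueness for the homogeneous KKT system of a constrained quadratic minimisation — abstract «one-block torus» form,
# and affine reproduction from translation covariance

HONEST FRAMING (binding, verbatim): "discharging BetaPertH makes Balaban's UV stability UNCONDITIONAL — a real
constructive-QFT result; it is NOT the continuum limit and NOT the Clay problem."  This module is NOT summit progress.

WHAT THIS FILE IS.  [folklore] finite-dimensional / Hilbert-space linear algebra, every hypothesis a binder; nothing of
Bałaban's manuscripts is asserted (the citations below are CONTEXT locators for where the abstract statement is used).

§1  THE HOMOGENEOUS KKT SYSTEM HAS ONLY THE ZERO SOLUTION.  Data: real inner-product spaces `V0, V1, V2, W`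
(0-cochains, 1-cochains, 2-cochains, coarse data), linear maps `d0 : V0 → V1`, `d1 : V1 → V2` with formal adjoints
`δ0, δ1` (adjointness as HYPOTHESES `hadj0`, `hadj1` — no completeness / finite-dimensionality needed), an «averaging»
`Q : V1 → W` with formal adjoint `Qt`, a symmetric «gauge» operator `R : V0 → V0`, and a submodule `Cst ≤ V1` of
«constant 1-cochains».  HYPOTHESES (named, all load-bearing — see the witnesses of §3):
  (Hdg)  `∀ D, d1 D = 0 → ∃ c ∈ Cst, ∃ λ, D = c + d0 λ`      — closed ⇒ constant + exact (H¹ of the one-block torus);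
  (Qc)   `∀ c ∈ Cst, Q c = 0 → c = 0`                       — the average sees constants (κ ≠ 0);
  (Qd)   `∀ λ, Q (d0 λ) = 0`                                 — on the ONE-block torus the coarse lattice is a point, so
                                                               the intertwining `Q ∘ d0 = d′ ∘ Q₀` has `d′ = 0`;
  (RΔ)   `∀ λ, R (δ0 (d0 λ)) = δ0 (d0 λ)`                     — R fixes the range of the Laplacian `Δ = δ0 d0`
                                                               (one block: `N(Q′) ⊕ ℝ·1` is everything and `Δ1 = 0`).
  CONCLUSION `torus_uniqueness`: if `δ1 (d1 D) = Qt φ + d0 (R ψ)` (stationarity with multipliers), `Q D = 0` (averaging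
  constraint) and `R (δ0 D) = 0` (gauge constraint) then `D = 0`.  PROOF (eight lines): pair the stationarity equation
  with `D`: `‖d1 D‖² = ⟪Q D, φ⟫ + ⟪R (δ0 D), ψ⟫ = 0`, so `d1 D = 0`; by (Hdg) `D = c + d0 λ`; by (Qd) `Q D = Q c`, so (Qc)
  gives `c = 0`; then `R (δ0 D) = R (Δ λ) = Δ λ = 0` by (RΔ), and `‖d0 λ‖² = ⟪λ, Δ λ⟫ = 0`, so `D = d0 λ = 0`.
  `multipliers_exact_part_zero`: under (Qd) alone, `Qt φ + d0 ρ = 0 → Qt φ = 0 ∧ d0 ρ = 0` (the two ranges are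
  orthogonal); with `Q` onto (`Qt` injective, hypothesis) also `φ = 0` — the k = 0 KKT matrix is injective
  (`kkt_homogeneous_trivial`).

§2  AFFINE REPRODUCTION FROM TRANSLATION COVARIANCE (pure linear algebra over any ring).  `E : V →ₗ V'` (think
`E A′ = 𝐇_∞ 𝒬 A′ − A′`), commuting families of «translations» `τ a : V →ₗ V`, `τ' a : V' →ₗ V'` with `E ∘ τ a = τ' a ∘ E`
(covariance).  If every `τ'`-INVARIANT («periodic») value `E x` vanishes (hypothesis `hTU` — this is where §1 is used
after periodisation), then: `E c = 0` for every `τ`-invariant `c` (`reproduction_of_invariant`), and `E A′ = 0` for every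
`A′` whose translates differ from it by `τ`-invariant vectors, `τ a A′ = A′ + c a` (`affine_reproduction_of_covariance`) —
affine data are reproduced, with NO Floquet theory and no fibre other than k = 0.

§3  WITNESSES that the hypotheses of §1 are jointly satisfiable and that (Hdg) and (RΔ) are each NEEDED (drop one and a
non-zero solution of the homogeneous system exists): `example`s over `ℝ` / `ℝ × ℝ`-free instances with all maps explicit.

CONTEXT (locators only; nothing used): the constrained minimisation «minimum of ½⟨A, ΔA⟩ under L^kηQ_kA = B, RD*A = 0»
[Balaban1985Variational] p. 285 (45); R = orthogonal projection onto Δ(N(Q′)) [Balaban1985BackgroundPropagators] p. 394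
(3.21); the straight-contour average [Balaban1984PropagatorsI] p. 19 (1.11).  The instance data for (Qc)/(Qd) come from the
sibling module `Beta.AffineAveraging` (`contourSum_affine` with m = 0: κ = L^(d+1); `contourSum_dz`), for (Hdg) from
periodic cochain cohomology (closed N-periodic 1-cochains on ℤ^d are constant + d0 of an N-periodic 0-cochain), for (RΔ)
from `N(Q′) ⊕ ℝ·1 = V0` on one block; those bridges are NOT in this file.
-/

namespace Literature.MathematicalPhysics.QuantumFieldTheory.Balaban1983to89.Beta.TorusKKTUniqueness

open scoped InnerProductSpace

/-! ## §1 The homogeneous KKT system on the one-block torus has only the zero solution -/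

section KKT

variable {V0 V1 V2 W : Type*}
  [NormedAddCommGroup V0] [InnerProductSpace ℝ V0] [NormedAddCommGroup V1] [InnerProductSpace ℝ V1]
  [NormedAddCommGroup V2] [InnerProductSpace ℝ V2] [NormedAddCommGroup W] [InnerProductSpace ℝ W]

/-- **PAIRING STEP**: if `δ1 (d1 D) = Qt φ + d0 (R ψ)` with `Q D = 0` and `R (δ0 D) = 0` (R symmetric, δ's and Qt formal
adjoints), then `d1 D = 0`. [folklore] -/
theorem d1_eq_zero_of_kkt
    (d0 : V0 →ₗ[ℝ] V1) (δ0 : V1 →ₗ[ℝ] V0) (hadj0 : ∀ (l : V0) (D : V1), ⟪d0 l, D⟫_ℝ = ⟪l, δ0 D⟫_ℝ)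
    (d1 : V1 →ₗ[ℝ] V2) (δ1 : V2 →ₗ[ℝ] V1) (hadj1 : ∀ (D : V1) (F : V2), ⟪d1 D, F⟫_ℝ = ⟪D, δ1 F⟫_ℝ)
    (Q : V1 →ₗ[ℝ] W) (Qt : W →ₗ[ℝ] V1) (hadjQ : ∀ (D : V1) (φ : W), ⟪Q D, φ⟫_ℝ = ⟪D, Qt φ⟫_ℝ)
    (R : V0 →ₗ[ℝ] V0) (hR : ∀ a b : V0, ⟪R a, b⟫_ℝ = ⟪a, R b⟫_ℝ)
    {D : V1} {φ : W} {ψ : V0}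
    (hstat : δ1 (d1 D) = Qt φ + d0 (R ψ)) (hQ : Q D = 0) (hg : R (δ0 D) = 0) : d1 D = 0 := by
  have h : ⟪d1 D, d1 D⟫_ℝ = 0 := by
    calc ⟪d1 D, d1 D⟫_ℝ = ⟪D, δ1 (d1 D)⟫_ℝ := hadj1 D (d1 D)
      _ = ⟪D, Qt φ⟫_ℝ + ⟪D, d0 (R ψ)⟫_ℝ := by rw [hstat, inner_add_right]
      _ = ⟪Q D, φ⟫_ℝ + ⟪R (δ0 D), ψ⟫_ℝ := by
          rw [hadjQ, hR, ← real_inner_comm (δ0 D) (R ψ), ← hadj0 (R ψ) D, real_inner_comm D (d0 (R ψ))]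
      _ = 0 := by rw [hQ, hg, inner_zero_left, inner_zero_left, add_zero]
  exact inner_self_eq_zero.1 h

/-- **EXACT AND GAUGE-FIXED ⇒ ZERO**: if `R (δ0 (d0 λ)) = 0` and R fixes `δ0 (d0 λ)`, then `d0 λ = 0`. [folklore] -/
theorem d0_eq_zero_of_gauge
    (d0 : V0 →ₗ[ℝ] V1) (δ0 : V1 →ₗ[ℝ] V0) (hadj0 : ∀ (l : V0) (D : V1), ⟪d0 l, D⟫_ℝ = ⟪l, δ0 D⟫_ℝ)
    (R : V0 →ₗ[ℝ] V0) {l : V0} (hRΔ : R (δ0 (d0 l)) = δ0 (d0 l)) (hg : R (δ0 (d0 l)) = 0) : d0 l = 0 := by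
  have hΔ : δ0 (d0 l) = 0 := by rw [← hRΔ]; exact hg
  have h : ⟪d0 l, d0 l⟫_ℝ = 0 := by rw [hadj0, hΔ, inner_zero_right]
  exact inner_self_eq_zero.1 h

/-- **TORUS UNIQUENESS (TU)**: under (Hdg), (Qc), (Qd), (RΔ) the homogeneous KKT system
`δ1 d1 D = Qt φ + d0 (R ψ)`, `Q D = 0`, `R δ0 D = 0` forces `D = 0`. [folklore] -/
theorem torus_uniqueness
    (d0 : V0 →ₗ[ℝ] V1) (δ0 : V1 →ₗ[ℝ] V0) (hadj0 : ∀ (l : V0) (D : V1), ⟪d0 l, D⟫_ℝ = ⟪l, δ0 D⟫_ℝ)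
    (d1 : V1 →ₗ[ℝ] V2) (δ1 : V2 →ₗ[ℝ] V1) (hadj1 : ∀ (D : V1) (F : V2), ⟪d1 D, F⟫_ℝ = ⟪D, δ1 F⟫_ℝ)
    (Q : V1 →ₗ[ℝ] W) (Qt : W →ₗ[ℝ] V1) (hadjQ : ∀ (D : V1) (φ : W), ⟪Q D, φ⟫_ℝ = ⟪D, Qt φ⟫_ℝ)
    (R : V0 →ₗ[ℝ] V0) (hR : ∀ a b : V0, ⟪R a, b⟫_ℝ = ⟪a, R b⟫_ℝ)
    (Cst : Submodule ℝ V1)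
    (hHdg : ∀ D : V1, d1 D = 0 → ∃ c ∈ Cst, ∃ l : V0, D = c + d0 l)
    (hQc : ∀ c ∈ Cst, Q c = 0 → c = 0)
    (hQd : ∀ l : V0, Q (d0 l) = 0)
    (hRΔ : ∀ l : V0, R (δ0 (d0 l)) = δ0 (d0 l))
    {D : V1} {φ : W} {ψ : V0}
    (hstat : δ1 (d1 D) = Qt φ + d0 (R ψ)) (hQ : Q D = 0) (hg : R (δ0 D) = 0) : D = 0 := by
  have hd1 : d1 D = 0 := d1_eq_zero_of_kkt d0 δ0 hadj0 d1 δ1 hadj1 Q Qt hadjQ R hR hstat hQ hg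
  obtain ⟨c, hc, l, hD⟩ := hHdg D hd1
  have hc0 : c = 0 := by
    apply hQc c hc
    have : Q D = Q c := by rw [hD, map_add, hQd, add_zero]
    rw [← this, hQ]
  rw [hc0, zero_add] at hD
  subst hD
  exact d0_eq_zero_of_gauge d0 δ0 hadj0 R (hRΔ l) hg

/-- **THE MULTIPLIER RANGES ARE ORTHOGONAL** on the one-block torus: under (Qd), `Qt φ + d0 ρ = 0` forces
`Qt φ = 0` and `d0 ρ = 0`. [folklore] -/
theorem multipliers_exact_part_zero
    (d0 : V0 →ₗ[ℝ] V1)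
    (Q : V1 →ₗ[ℝ] W) (Qt : W →ₗ[ℝ] V1) (hadjQ : ∀ (D : V1) (φ : W), ⟪Q D, φ⟫_ℝ = ⟪D, Qt φ⟫_ℝ)
    (hQd : ∀ l : V0, Q (d0 l) = 0)
    {φ : W} {ρ : V0} (h : Qt φ + d0 ρ = 0) : Qt φ = 0 ∧ d0 ρ = 0 := by
  have horth : ⟪d0 ρ, Qt φ⟫_ℝ = 0 := by rw [← hadjQ, hQd, inner_zero_left]
  have hQt : Qt φ = -d0 ρ := eq_neg_of_add_eq_zero_left h
  have hself : ⟪d0 ρ, d0 ρ⟫_ℝ = 0 := by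
    have : ⟪d0 ρ, -d0 ρ⟫_ℝ = 0 := by rw [← hQt]; exact horth
    rwa [inner_neg_right, neg_eq_zero] at this
  have hρ : d0 ρ = 0 := inner_self_eq_zero.1 hself
  refine ⟨?_, hρ⟩
  rw [hQt, hρ, neg_zero]

/-- **THE k = 0 KKT MATRIX IS INJECTIVE**: under (Hdg), (Qc), (Qd), (RΔ) and `Qt` injective (the average is onto), the
homogeneous system in the unknowns `(D, φ, ρ := R ψ)` has only the trivial solution `D = 0, φ = 0, d0 (R ψ) = 0`.
[folklore] -/
theorem kkt_homogeneous_trivial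
    (d0 : V0 →ₗ[ℝ] V1) (δ0 : V1 →ₗ[ℝ] V0) (hadj0 : ∀ (l : V0) (D : V1), ⟪d0 l, D⟫_ℝ = ⟪l, δ0 D⟫_ℝ)
    (d1 : V1 →ₗ[ℝ] V2) (δ1 : V2 →ₗ[ℝ] V1) (hadj1 : ∀ (D : V1) (F : V2), ⟪d1 D, F⟫_ℝ = ⟪D, δ1 F⟫_ℝ)
    (Q : V1 →ₗ[ℝ] W) (Qt : W →ₗ[ℝ] V1) (hadjQ : ∀ (D : V1) (φ : W), ⟪Q D, φ⟫_ℝ = ⟪D, Qt φ⟫_ℝ)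
    (hQt : Function.Injective Qt)
    (R : V0 →ₗ[ℝ] V0) (hR : ∀ a b : V0, ⟪R a, b⟫_ℝ = ⟪a, R b⟫_ℝ)
    (Cst : Submodule ℝ V1)
    (hHdg : ∀ D : V1, d1 D = 0 → ∃ c ∈ Cst, ∃ l : V0, D = c + d0 l)
    (hQc : ∀ c ∈ Cst, Q c = 0 → c = 0)
    (hQd : ∀ l : V0, Q (d0 l) = 0)
    (hRΔ : ∀ l : V0, R (δ0 (d0 l)) = δ0 (d0 l))
    {D : V1} {φ : W} {ψ : V0}
    (hstat : δ1 (d1 D) = Qt φ + d0 (R ψ)) (hQ : Q D = 0) (hg : R (δ0 D) = 0) :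
    D = 0 ∧ φ = 0 ∧ d0 (R ψ) = 0 := by
  have hD : D = 0 :=
    torus_uniqueness d0 δ0 hadj0 d1 δ1 hadj1 Q Qt hadjQ R hR Cst hHdg hQc hQd hRΔ hstat hQ hg
  have hsum : Qt φ + d0 (R ψ) = 0 := by rw [← hstat, hD, map_zero, map_zero]
  obtain ⟨hQtφ, hρ⟩ := multipliers_exact_part_zero d0 Q Qt hadjQ hQd hsum
  refine ⟨hD, hQt ?_, hρ⟩
  rw [hQtφ, map_zero]

end KKT

/-! ## §2 Affine reproduction from translation covariance -/

section Covariance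

variable {S : Type*} [CommRing S] {V V' : Type*} [AddCommGroup V] [Module S V] [AddCommGroup V'] [Module S V']
  {ι : Type*}

/-- **INVARIANT DATA ARE REPRODUCED**: if `E` is covariant (`E (τ a x) = τ' a (E x)`) and every `τ'`-invariant value of
`E` vanishes, then `E c = 0` for every `τ`-invariant `c`. [folklore] -/
theorem reproduction_of_invariant (E : V →ₗ[S] V') (τ : ι → V →ₗ[S] V) (τ' : ι → V' →ₗ[S] V')
    (hcov : ∀ (a : ι) (x : V), E (τ a x) = τ' a (E x))
    (hTU : ∀ x : V, (∀ a, τ' a (E x) = E x) → E x = 0)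
    {c : V} (hc : ∀ a, τ a c = c) : E c = 0 :=
  hTU c fun a => by rw [← hcov, hc]

/-- **AFFINE REPRODUCTION FROM COVARIANCE**: if moreover `τ a A′ = A′ + c a` with every `c a` `τ`-invariant (affine data:
translates differ by constants), then `E A′ = 0` — with no Floquet theory and no quasi-momentum other than zero.
[folklore] -/
theorem affine_reproduction_of_covariance (E : V →ₗ[S] V') (τ : ι → V →ₗ[S] V) (τ' : ι → V' →ₗ[S] V')
    (hcov : ∀ (a : ι) (x : V), E (τ a x) = τ' a (E x))
    (hTU : ∀ x : V, (∀ a, τ' a (E x) = E x) → E x = 0)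
    {A' : V} (c : ι → V) (hshift : ∀ a, τ a A' = A' + c a) (hc : ∀ a b, τ b (c a) = c a) : E A' = 0 := by
  have hEc : ∀ a, E (c a) = 0 := fun a => reproduction_of_invariant E τ τ' hcov hTU (hc a)
  exact hTU A' fun a => by rw [← hcov, hshift, map_add, hEc, add_zero]

end Covariance

/-! ## §3 Witnesses: the hypotheses of §1 are jointly satisfiable, and (Hdg), (RΔ) are each needed -/

section Witnesses

/-- The zero map and the identity of `ℝ` as `ℝ`-linear maps (abbreviations for the witnesses). [folklore] -/
abbrev O : ℝ →ₗ[ℝ] ℝ := 0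
/-- [folklore] -/
abbrev I : ℝ →ₗ[ℝ] ℝ := LinearMap.id

/-- SATISFIABLE: `V0 = V1 = V2 = W = ℝ`, `d0 = 0`, `d1 = 0`, `Q = I`, `R = I`, `Cst = ⊤` meet (Hdg), (Qc), (Qd), (RΔ)
(the conclusion `D = 0` is then just the constraint `Q D = 0`). [folklore] -/
example : (∀ D : ℝ, O D = 0 → ∃ c ∈ (⊤ : Submodule ℝ ℝ), ∃ l : ℝ, D = c + O l) ∧
    (∀ c ∈ (⊤ : Submodule ℝ ℝ), I c = 0 → c = 0) ∧ (∀ l : ℝ, I (O l) = 0) ∧ (∀ l : ℝ, I (O (O l)) = O (O l)) := by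
  refine ⟨fun D _ => ⟨D, Submodule.mem_top, 0, by simp⟩, fun c _ h => by simpa using h, fun l => by simp, fun l => by simp⟩

/-- (Hdg) IS NEEDED: `d0 = δ0 = 0`, `d1 = δ1 = 0`, `Q = Qt = 0`, `R = I`, `Cst = ⊥`: (Qc), (Qd), (RΔ) hold; the homogeneous
system (stationarity, averaging constraint, gauge constraint) holds for `D = 1`, `φ = ψ = 0`; `1 ≠ 0`; and (Hdg) FAILS.
[folklore] -/
example : (∀ c ∈ (⊥ : Submodule ℝ ℝ), O c = 0 → c = 0) ∧ (∀ l : ℝ, O (O l) = 0) ∧ (∀ l : ℝ, I (O (O l)) = O (O l)) ∧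
    (O (O (1 : ℝ)) = O (0 : ℝ) + O (I (0 : ℝ)) ∧ O (1 : ℝ) = 0 ∧ I (O (1 : ℝ)) = 0) ∧ (1 : ℝ) ≠ 0 ∧
    ¬ (∀ D : ℝ, O D = 0 → ∃ c ∈ (⊥ : Submodule ℝ ℝ), ∃ l : ℝ, D = c + O l) := by
  refine ⟨fun c hc _ => by simpa using hc, fun l => by simp, fun l => by simp, ⟨by simp, by simp, by simp⟩, one_ne_zero, ?_⟩
  intro h
  obtain ⟨c, hc, l, h1⟩ := h 1 (by simp)
  rw [Submodule.mem_bot] at hc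
  simp [hc] at h1

/-- (RΔ) IS NEEDED: `d0 = δ0 = I`, `d1 = δ1 = 0`, `Q = Qt = 0`, `R = 0`, `Cst = ⊥`: (Hdg) (every `D` is exact), (Qc), (Qd)
hold; the homogeneous system holds for `D = 1`, `φ = ψ = 0` (stationarity `0 = 0 + d0 (R 0)`, averaging `0 = 0`, gauge
`R (δ0 1) = 0`); `1 ≠ 0`; and (RΔ) FAILS (`R (Δ 1) = 0 ≠ 1`). [folklore] -/
example : (∀ D : ℝ, O D = 0 → ∃ c ∈ (⊥ : Submodule ℝ ℝ), ∃ l : ℝ, D = c + I l) ∧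
    (∀ c ∈ (⊥ : Submodule ℝ ℝ), O c = 0 → c = 0) ∧ (∀ l : ℝ, O (I l) = 0) ∧
    (O (O (1 : ℝ)) = O (0 : ℝ) + I (O (0 : ℝ)) ∧ O (1 : ℝ) = 0 ∧ O (I (1 : ℝ)) = 0) ∧ (1 : ℝ) ≠ 0 ∧
    ¬ (∀ l : ℝ, O (I (I l)) = I (I l)) := by
  refine ⟨fun D _ => ⟨0, Submodule.zero_mem _, D, by simp⟩, fun c hc _ => by simpa using hc, fun l => by simp,
    ⟨by simp, by simp, by simp⟩, one_ne_zero, ?_⟩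
  intro h
  simpa using h 1

end Witnesses

end Literature.MathematicalPhysics.QuantumFieldTheory.Balaban1983to89.Beta.TorusKKTUniqueness
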